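import Summits.ValiantsHypothesis.ValiantsHypothesis.Theorems.PolyaContinuedSignedCoverLittlePipeline
import Summits.ValiantsHypothesis.ValiantsHypothesis.Theorems.PolyaContinuedSignedCoverLittleCount
import Summits.ValiantsHypothesis.ValiantsHypothesis.Theorems.PolyaContinuedSignedCoverLittleCaseB
import Summits.ValiantsHypothesis.ValiantsHypothesis.Theorems.PolyaContinuedSignedCoverLittleEvenCells
import Literature.Combinatorics.SimpleGraph.LittleTheorem
import HarnessLib

/-!
# Route PolyaContinued — support item `SignedCoverLittle` (stmt-ValiantsHypothesis-7426):
# assembly of the H-side — `stub_even` of the line `even_induction`, and the item modulo `stub_chain`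

Final assembly of §2 of the paper proof `proof-LabelTransfer.md` for the STANDARD target of the
lead's line `even_induction` (`kstd n` = `K_{3,3}` on the indices `0,1,2` plus the diagonal, given
here by its defining filter so that the statements apply to the line's `kstd`/`LabelId` by `rfl`):

  normal form (`exists_normalForm_kstd`) → the five dicircuits of `D(H')`
  (`card_filter_ne_one_eq_five`, `isCycle_inv_mul_of_isPerfectMatching`,
  `mem_filter_of_isCycle_of_forall_apply`) → the lifted fork pair `γ₊, γ₋` with `≥ 3` forks
  (`exists_lifted_fork_pair` + the (CS) count `card_forks_le_of_labelExponent_eq`) → the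
  two-circuit ear lemma, Case B (`ear_caseB_fin`) → even coverage.

* `not_isPfaffianBipartite_of_labelIdentity_kstd` — **a source label-bijecting onto a relabelled
  standard target (`n ≥ 3`) is NOT Pfaffian** (`not_isPfaffianBipartite_of_three_le_forks`);
* `even_multiplicity_of_labelIdentity_kstd` — **(EVEN)**: every cell of such a source lies in an
  even number of its perfect matchings (`even_card_filter_caseB`); this is the registered stub
  `stub_even` of the line with `LabelId`/`kstd` unfolded (the line closes it by `exact`);
* `signedCoverLittle_of_chain` — **the item modulo the E-side chain**: if every non-Pfaffian
  target reduces, inside a subgraph of the source, to a label identity onto a relabelled standard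
  target (the line's `stub_chain`, unfolded), then `SignedCoverLittle` holds.

All statements over `ℂ` and `Fin n`; no new definitions.
-/

noncomputable section

namespace Summit.ValiantsHypothesis.PolyaContinued

open MvPolynomial Finset Literature.Combinatorics.SimpleGraph Equiv

variable {n : ℕ}

/-! ### The Case-B data of a normalised source -/

section Normalised

variable {H E : Finset (Fin n × Fin n)} {φ : Fin n × Fin n → Fin n × Fin n} {A : Finset (Fin n)}

/-- **The H-side of the paper proof, normalised setting.** From a label identity in normal form
onto "`K_{3,3}` on a `3`-set plus the diagonal": the lifted fork pair `γ₊ ≠ γ₋` (dicircuits of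
`D(H)`), the finset `S` of the five dicircuits with its closure and single-cycle properties, and
`≥ 3` forks — i.e. all hypotheses of `ear_caseB_fin` / `not_isPfaffianBipartite_of_three_le_forks`.
[folklore] -/
theorem exists_caseB_input
    (hid : (∑ σ : Equiv.Perm (Fin n), if (∀ i, (i, σ i) ∈ H) then
        ∏ i, (X (φ (i, σ i)) : MvPolynomial (Fin n × Fin n) ℂ) else 0) =
      perfectMatchingPoly E ℂ)
    (hφ : ∀ i, φ (i, i) = (i, i)) (hHd : ∀ i, (i, i) ∈ H)
    (hE : ∀ x y, (x, y) ∈ E ↔ (x ∈ A ∧ y ∈ A) ∨ x = y) (hA : A.card = 3) :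
    ∃ γp γm : Perm (Fin n), γp.IsCycle ∧ γm.IsCycle ∧ (∀ i, (i, γp i) ∈ H) ∧
      (∀ i, (i, γm i) ∈ H) ∧ γp ≠ γm ∧
      (Finset.univ.filter fun σ : Perm (Fin n) => (∀ i, (i, σ i) ∈ H) ∧ σ ≠ 1).card ≤ 5 ∧
      γp ∈ (Finset.univ.filter fun σ : Perm (Fin n) => (∀ i, (i, σ i) ∈ H) ∧ σ ≠ 1) ∧
      γm ∈ (Finset.univ.filter fun σ : Perm (Fin n) => (∀ i, (i, σ i) ∈ H) ∧ σ ≠ 1) ∧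
      (∀ c : Perm (Fin n), c.IsCycle → (∀ v, c v = γp v ∨ c v = γm v ∨ c v = v) →
        c ∈ (Finset.univ.filter fun σ : Perm (Fin n) => (∀ i, (i, σ i) ∈ H) ∧ σ ≠ 1)) ∧
      (∀ c ∈ (Finset.univ.filter fun σ : Perm (Fin n) => (∀ i, (i, σ i) ∈ H) ∧ σ ≠ 1),
        ∀ c' ∈ (Finset.univ.filter fun σ : Perm (Fin n) => (∀ i, (i, σ i) ∈ H) ∧ σ ≠ 1),
        c ≠ c' → (c⁻¹ * c').IsCycle) ∧
      3 ≤ (forks γp γm).card := by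
  obtain ⟨γp, γm, δp, δm, hγp, hγm, hp1, hm1, hpm, hγpc, hγmc, hγpδ, hγmδ, hforks⟩ :=
    exists_lifted_fork_pair hid hφ hHd hE hA
  refine ⟨γp, γm, hγpc, hγmc, hγp, hγm, hpm, (card_filter_ne_one_eq_five hid hHd hE hA).le,
    Finset.mem_filter.2 ⟨Finset.mem_univ _, hγp, hp1⟩,
    Finset.mem_filter.2 ⟨Finset.mem_univ _, hγm, hm1⟩,
    fun c hc hcv => mem_filter_of_isCycle_of_forall_apply hHd hγp hγm hc hcv,
    fun c hc c' hc' hne => isCycle_inv_mul_of_isPerfectMatching hid hE hA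
      (Finset.mem_filter.1 hc).2.1 (Finset.mem_filter.1 hc').2.1 hne, ?_⟩
  exact le_trans hforks (card_forks_le_of_labelExponent_eq hφ hγpδ hγmδ)

/-- **A normalised source label-bijecting onto `K_{3,3}`-on-a-`3`-set ⊔ diagonal is not
Pfaffian** (two-circuit ear lemma + certificate, `not_isPfaffianBipartite_of_three_le_forks`).
[folklore] -/
theorem not_isPfaffianBipartite_of_labelIdentity_shape
    (hid : (∑ σ : Equiv.Perm (Fin n), if (∀ i, (i, σ i) ∈ H) then
        ∏ i, (X (φ (i, σ i)) : MvPolynomial (Fin n × Fin n) ℂ) else 0) =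
      perfectMatchingPoly E ℂ)
    (hφ : ∀ i, φ (i, i) = (i, i)) (hHd : ∀ i, (i, i) ∈ H)
    (hE : ∀ x y, (x, y) ∈ E ↔ (x ∈ A ∧ y ∈ A) ∨ x = y) (hA : A.card = 3) :
    ¬ IsPfaffianBipartite H := by
  obtain ⟨γp, γm, hγpc, hγmc, hγp, hγm, -, hS5, hpS, hmS, hS, hcyc, h3⟩ :=
    exists_caseB_input hid hφ hHd hE hA
  exact not_isPfaffianBipartite_of_three_le_forks hHd hγpc hγmc hγp hγm _ hS5 hpS hmS hS hcyc h3

/-- **(EVEN), normalised setting**: every cell lies in an even number of perfect matchings of the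
source (the perfect matchings are exactly the six of the Case-B configuration;
`even_card_filter_caseB`). [folklore] -/
theorem even_multiplicity_of_labelIdentity_shape
    (hid : (∑ σ : Equiv.Perm (Fin n), if (∀ i, (i, σ i) ∈ H) then
        ∏ i, (X (φ (i, σ i)) : MvPolynomial (Fin n × Fin n) ℂ) else 0) =
      perfectMatchingPoly E ℂ)
    (hφ : ∀ i, φ (i, i) = (i, i)) (hHd : ∀ i, (i, i) ∈ H)
    (hE : ∀ x y, (x, y) ∈ E ↔ (x ∈ A ∧ y ∈ A) ∨ x = y) (hA : A.card = 3)
    (c : Fin n × Fin n) :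
    Even (Finset.univ.filter fun σ : Perm (Fin n) =>
      (∀ i, (i, σ i) ∈ H) ∧ σ c.1 = c.2).card := by
  classical
  obtain ⟨γp, γm, hγpc, hγmc, hγp, hγm, hpm, hS5, hpS, hmS, hS, hcyc, h3⟩ :=
    exists_caseB_input hid hφ hHd hE hA
  set S := Finset.univ.filter fun σ : Perm (Fin n) => (∀ i, (i, σ i) ∈ H) ∧ σ ≠ 1 with hSdef
  obtain ⟨p, Z, hpF, -, -, hZc, hZS, hZne, hZinj, hZμ, hZν, hZfix, -, -, hμpart, hνpart, -⟩ :=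
    ear_caseB_fin hγpc hγmc S hS5 hpS hmS hS hcyc h3
  have hS5' : S.card = 5 := card_filter_ne_one_eq_five hid hHd hE hA
  -- the five dicircuits are `γp, γm, Z 0, Z 1, Z 2`
  have hnodup : [(1 : Perm (Fin n)), γp, γm, Z 0, Z 1, Z 2].Nodup :=
    nodup_caseB hγpc hγmc hpm hZc hZinj (fun j => (hZne j).1) (fun j => (hZne j).2)
  set T : Finset (Perm (Fin n)) := [γp, γm, Z 0, Z 1, Z 2].toFinset with hT
  have hTS : T ⊆ S := by
    intro σ hσ
    rw [hT, List.mem_toFinset] at hσ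
    simp only [List.mem_cons, List.not_mem_nil, or_false] at hσ
    rcases hσ with rfl | rfl | rfl | rfl | rfl
    exacts [hpS, hmS, hZS 0, hZS 1, hZS 2]
  have hTcard : T.card = 5 := by
    rw [hT, List.toFinset_card_of_nodup hnodup.of_cons]
    rfl
  have hTeq : T = S := Finset.eq_of_subset_of_card_le hTS (by rw [hTcard, hS5'])
  have hPM : ∀ σ : Perm (Fin n), (∀ i, (i, σ i) ∈ H) ↔
      σ ∈ [(1 : Perm (Fin n)), γp, γm, Z 0, Z 1, Z 2] := by
    intro σ
    constructor
    · intro hσ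
      by_cases h1 : σ = 1
      · rw [h1]; exact List.mem_cons_self
      · have hσS : σ ∈ S := Finset.mem_filter.2 ⟨Finset.mem_univ _, hσ, h1⟩
        rw [← hTeq, hT, List.mem_toFinset] at hσS
        exact List.mem_cons_of_mem _ hσS
    · intro hσ
      rw [List.mem_cons] at hσ
      rcases hσ with rfl | hσ
      · intro i; simpa using hHd i
      · have hσT : σ ∈ T := by rw [hT, List.mem_toFinset]; exact hσ
        exact (Finset.mem_filter.1 (hTS hσT)).2.1
  exact even_card_filter_caseB hPM hγpc hγmc hpm hZc hZinj (fun j => (hZne j).1)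
    (fun j => (hZne j).2) (fun j => mem_support_of_mem_forks_left (hpF j))
    (fun j => mem_support_of_mem_forks_right (hpF j)) hZμ hZν hZfix hμpart hνpart c

end Normalised

/-! ### The standard target of the line `even_induction` -/

/-- **A source label-bijecting onto a relabelled standard target is not Pfaffian** (`n ≥ 3`;
`kstd n` by its defining filter). With the line's `stub_chain` this is the whole item
(`signedCoverLittle_of_chain`). [folklore] -/
theorem not_isPfaffianBipartite_of_labelIdentity_kstd {H : Finset (Fin n × Fin n)}
    {φ : Fin n × Fin n → Fin n × Fin n} {ρ κ : Perm (Fin n)} (hn : 3 ≤ n)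
    (hid : (∑ σ : Equiv.Perm (Fin n), if (∀ i, (i, σ i) ∈ H) then
        ∏ i, (X (φ (i, σ i)) : MvPolynomial (Fin n × Fin n) ℂ) else 0) =
      perfectMatchingPoly (relabel (Finset.univ.filter fun e : Fin n × Fin n =>
        ((e.1 : ℕ) < 3 ∧ (e.2 : ℕ) < 3) ∨ (e.1 = e.2 ∧ 3 ≤ (e.1 : ℕ))) ρ κ) ℂ) :
    ¬ IsPfaffianBipartite H := by
  obtain ⟨H', E', φ', A, hP, hD, hφ', hid', hE', hA, -⟩ := exists_normalForm_kstd hn hid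
  rw [hP]
  exact not_isPfaffianBipartite_of_labelIdentity_shape hid' hφ' hD hE' hA

/-- **(EVEN) = `stub_even` of the line `even_induction`, with `LabelId` and `kstd` unfolded**: a
label bijection onto a relabelled standard target (`n ≥ 3`) forces every cell of the source to lie
in an even number of its perfect matchings. [folklore] -/
theorem even_multiplicity_of_labelIdentity_kstd :
    ∀ (n : ℕ) (H : Finset (Fin n × Fin n)) (φ : Fin n × Fin n → Fin n × Fin n)
      (ρ κ : Perm (Fin n)), 3 ≤ n →
      (∑ σ : Equiv.Perm (Fin n), if (∀ i, (i, σ i) ∈ H) then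
          ∏ i, (X (φ (i, σ i)) : MvPolynomial (Fin n × Fin n) ℂ) else 0) =
        perfectMatchingPoly (relabel (Finset.univ.filter fun e : Fin n × Fin n =>
          ((e.1 : ℕ) < 3 ∧ (e.2 : ℕ) < 3) ∨ (e.1 = e.2 ∧ 3 ≤ (e.1 : ℕ))) ρ κ) ℂ →
      ∀ c : Fin n × Fin n, Even ((Finset.univ.filter fun σ : Perm (Fin n) =>
        (∀ i, (i, σ i) ∈ H) ∧ σ c.1 = c.2).card) := by
  intro n H φ ρ κ hn hid c
  obtain ⟨H', E', φ', A, -, hD, hφ', hid', hE', hA, hmult⟩ := exists_normalForm_kstd hn hid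
  obtain ⟨x, y, hxy⟩ := hmult c.1 c.2
  rw [hxy]
  exact even_multiplicity_of_labelIdentity_shape hid' hφ' hD hE' hA (x, y)

/-- **`SignedCoverLittle` modulo the E-side chain.** If every label identity onto a non-Pfaffian
target reduces, inside a subgraph of the source, to a label identity onto a relabelled standard
target (the line's `stub_chain`, with `LabelId`/`kstd` unfolded), then `SignedCoverLittle` holds:
the source is Pfaffian, hence so is the subgraph (`IsPfaffianBipartite.anti`), contradicting
`not_isPfaffianBipartite_of_labelIdentity_kstd` (targets with `n < 3` are Pfaffian,
`isPfaffianBipartite_of_lt_three`). [folklore] -/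
theorem signedCoverLittle_of_chain
    (hchain : ∀ (n : ℕ) (H E : Finset (Fin n × Fin n)) (φ : Fin n × Fin n → Fin n × Fin n),
      (∑ σ : Equiv.Perm (Fin n), if (∀ i, (i, σ i) ∈ H) then
          ∏ i, (X (φ (i, σ i)) : MvPolynomial (Fin n × Fin n) ℂ) else 0) =
        perfectMatchingPoly E ℂ →
      ¬ IsPfaffianBipartite E →
      ∃ (H₁ : Finset (Fin n × Fin n)) (φ₁ : Fin n × Fin n → Fin n × Fin n) (ρ κ : Perm (Fin n)),
        H₁ ⊆ H ∧
        (∑ σ : Equiv.Perm (Fin n), if (∀ i, (i, σ i) ∈ H₁) then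
            ∏ i, (X (φ₁ (i, σ i)) : MvPolynomial (Fin n × Fin n) ℂ) else 0) =
          perfectMatchingPoly (relabel (Finset.univ.filter fun e : Fin n × Fin n =>
            ((e.1 : ℕ) < 3 ∧ (e.2 : ℕ) < 3) ∨ (e.1 = e.2 ∧ 3 ≤ (e.1 : ℕ))) ρ κ) ℂ) :
    Summit.ValiantsHypothesis.ValiantsHypothesis.Theses.PolyaContinued.SignedCoverLittle := by
  refine signedCoverLittle_of_labelTransfer fun n H E φ hH hid => ?_
  by_contra hE
  have hn : 3 ≤ n := by
    by_contra hlt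
    exact hE (isPfaffianBipartite_of_lt_three (not_le.1 hlt) E)
  obtain ⟨H₁, φ₁, ρ, κ, hsub, hid₁⟩ := hchain n H E φ hid hE
  exact not_isPfaffianBipartite_of_labelIdentity_kstd hn hid₁ (hH.anti hsub)

end Summit.ValiantsHypothesis.PolyaContinued
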